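import Literature.Geometry.Lorentzian.CoordCurvature
import HarnessLib

/-!
# The geometry of a coordinate slice in second-order Gaussian form

Coordinate tensor calculus (`MetricCoord`, `CoordCurvature.lean`: components
`G : E → (E →L E →L ℝ)` of a metric, `IsMetricOn G T`, Koszul form `koszulCLM`, Christoffel map
`chrAt`, curvature `riemAt`, Ricci form `ricAt`) on a product `E = ℝ × F`, `F` finite-dimensional:
points `(t, y)`, the time vector `e₀ = (1, 0)` and the spatial vectors `ṽ = (0, v)`. The slice is
`Σ = {0} × B`, `B ⊆ F` open with `(0, y) ∈ T` for `y ∈ B`.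

We say that `G` is **Gaussian to second order along `Σ`** (`IsGaussianSlice G B`) if at the points of
`Σ`

  `G(e₀, e₀) = −1`,  `G(e₀, ṽ) = 0`,  `∂_t G(e₀, ·) = 0`

(the coordinate `t`-lines leave `Σ` orthogonally, with unit speed, and with vanishing
acceleration: normal coordinates to second order, Wald 1984, §3.3, (3.3.26) at `Σ`; Hawking–Ellis
1973, §2.8 / §4.3 "synchronous" or Gaussian normal coordinates, of which only the `1`-jet along `Σ`
is used). Then `e₀` is the unit normal of `Σ`, the **induced metric** is `h(v, w) = G(ṽ, w̃)`
(`sliceMetric`) and the **second fundamental form** `K(v, w) = G(∇_ṽ e₀, w̃)` is `½ ∂_t G(ṽ, w̃)`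
(`sliceK`; Wald 1984, (10.2.13) `K_{ab} = ½ 𝓛_n h_{ab}`). This file proves, at the points of `Σ`:

* `IsGaussianSlice.isMetricOn_sliceMetric` — `h` is a nondegenerate metric on `B`;
* the vanishing of the spatial (and mixed second) derivatives of `G(e₀, e₀)`, `G(e₀, ṽ)`,
  `∂_t G(e₀, ·)` along `Σ`;
* **the Christoffel symbols** (`chrAt_svec_svec`, `chrAt_tvec_svec`, `chrAt_tvec_tvec`):
  `Γ(ṽ, w̃) = K(v,w) e₀ + (Γ_h(v,w))~`, `Γ(e₀, ṽ) = (♯_h K(v,·))~`, `Γ(e₀, e₀) = 0`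
  (Wald 1984, §10.2; the Gaussian-normal values `Γ⁰_{ij} = K_{ij}`, `Γ^j_{0i} = K^j_i`,
  `Γ^k_{ij} = Γ^k_{ij}[h]`, `Γ^a_{00} = Γ^0_{0i} = 0`);
* **the Gauss equation** `G(R(ũ, ṽ)w̃, z̃) = h(R_h(u,v)w, z) + K(v,w)K(u,z) − K(u,w)K(v,z)`
  (`apply_riemAt_svec`; O'Neill 1983, Ch. 4, Thm. 4.5, timelike unit normal `ε = −1`), the normal
  curvature `G(R(e₀, ṽ)w̃, e₀) = −½ ∂_t∂_t G(ṽ,w̃) + (K∘♯K)(v,w)` (`apply_riemAt_tvec`), and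
  **the Ricci tensor on spatial vectors**
  `Ric_G(ṽ, w̃) = ½ ∂_t∂_t G(ṽ, w̃) + Ric_h(v, w) + (tr_h K) K(v, w) − 2 (K∘♯K)(v, w)`
  (`ricAt_svec_svec`; the vacuum evolution equation `∂_t K = −Ric_h − (tr K) K + 2 K∘♯K` of
  Gaussian normal coordinates, Wald 1984, (10.2.25)–(10.2.27) with zero shift and unit lapse at `Σ`).

Everything is by the Koszul formula (`apply_chrAt`) and the first-kind curvature formula
(`IsMetricOn.apply_riemAt`) of `CoordCurvature.lean`; everything is proved. The definitions are
the explicit forms `sliceMetric`, `sliceK` and the predicate `IsGaussianSlice`; no statement of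
`Prop` type is assumed. Purpose: the Cauchy data of the Killing equation in the proof that Killing
initial data develop into Killing fields (Moncrief 1975; `CoordKillingCauchyData.lean`).

## References

* R. M. Wald, *General Relativity*, Chicago 1984, §3.3 (Gaussian normal coordinates), §10.2,
  (10.2.13), (10.2.25)–(10.2.27). [Wald1984]
* B. O'Neill, *Semi-Riemannian geometry with applications to relativity*, Academic Press 1983,
  Ch. 3, Prop. 3.13, Lemma 3.38; Ch. 4, Thm. 4.5 (Gauss equation). [ONeill1983]
* V. Moncrief, J. Math. Phys. 16 (1975) 493–498, §III. [Moncrief1975]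
-/

noncomputable section

-- instance search on the nested operator spaces `(ℝ × F) →L[ℝ] (ℝ × F) →L[ℝ] (ℝ × F) →L[ℝ] ℝ`
-- (second derivatives of the metric components) needs one more level of pending depth.
set_option maxSynthPendingDepth 3

open Set Filter ContinuousLinearMap Module
open scoped Topology ContDiff

namespace Literature.Geometry.Lorentzian

namespace MetricCoord

namespace GaussSlice

variable {F : Type*} [NormedAddCommGroup F] [NormedSpace ℝ F]

/-! ### The product structure `E = ℝ × F` -/

/-- The time vector `e₀ = (1, 0)` of `ℝ × F`. [folklore] -/
abbrev tvec : ℝ × F := ((1 : ℝ), (0 : F))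

/-- The spatial vector `ṽ = (0, v)` of `ℝ × F`. [folklore] -/
abbrev svec (v : F) : ℝ × F := ((0 : ℝ), v)

/-- Every vector of `ℝ × F` splits as `w = w.1 e₀ + (0, w.2)`. [folklore] -/
theorem eq_smul_tvec_add_svec (w : ℝ × F) : w = w.1 • (tvec : ℝ × F) + svec w.2 := by
  ext <;> simp

/-- The slice map `y ↦ (0, y)` has derivative `v ↦ (0, v)`. [folklore] -/
theorem hasFDerivAt_svec (y : F) : HasFDerivAt (fun y' : F ↦ svec y') (inr ℝ ℝ F) y :=
  hasFDerivAt_prodMk_right (0 : ℝ) y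

/-- **Chain rule along the slice**: `∂_v (Φ ∘ (0, ·))(y) = ∂_{ṽ} Φ(0, y)`. [folklore] -/
theorem fderiv_comp_svec {W : Type*} [NormedAddCommGroup W] [NormedSpace ℝ W] {Φ : ℝ × F → W} {y : F}
    (hΦ : DifferentiableAt ℝ Φ (svec y)) (v : F) :
    fderiv ℝ (fun y' : F ↦ Φ (svec y')) y v = fderiv ℝ Φ (svec y) (svec v) := by
  rw [show (fun y' : F ↦ Φ (svec y')) = Φ ∘ fun y' : F ↦ svec y' from rfl,
    fderiv_comp y hΦ (hasFDerivAt_svec y).differentiableAt, (hasFDerivAt_svec y).fderiv]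
  rfl

/-- A function constant on an open set has vanishing derivative there. [folklore] -/
theorem fderiv_eq_zero_of_eqOn_const {W : Type*} [NormedAddCommGroup W] [NormedSpace ℝ W] {f : F → W}
    {B : Set F} (hB : IsOpen B) {c : W} (hf : ∀ y ∈ B, f y = c) {y : F} (hy : y ∈ B) :
    fderiv ℝ f y = 0 := by
  have hev : f =ᶠ[𝓝 y] fun _ ↦ c := Filter.eventually_of_mem (hB.mem_nhds hy) hf
  rw [hev.fderiv_eq, fderiv_fun_const]
  rfl

/-! ### The slice data and the Gaussian condition -/

variable (F) in
/-- **Restriction of a bilinear form on `ℝ × F` to the spatial factor**, as a continuous linear map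
`B ↦ ((v, w) ↦ B(ṽ, w̃))`. [folklore] -/
def spatialPart : ((ℝ × F) →L[ℝ] (ℝ × F) →L[ℝ] ℝ) →L[ℝ] (F →L[ℝ] F →L[ℝ] ℝ) :=
  (compL ℝ F ((ℝ × F) →L[ℝ] ℝ) (F →L[ℝ] ℝ) ((compL ℝ F (ℝ × F) ℝ).flip (inr ℝ ℝ F))).comp
    ((compL ℝ F (ℝ × F) ((ℝ × F) →L[ℝ] ℝ)).flip (inr ℝ ℝ F))

/-- Unfolding lemma for `spatialPart`. [folklore] -/
@[simp] theorem spatialPart_apply (B : (ℝ × F) →L[ℝ] (ℝ × F) →L[ℝ] ℝ) (v w : F) :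
    spatialPart F B v w = B (svec v) (svec w) := rfl

/-- `spatialPart` is smooth (it is continuous linear). [folklore] -/
theorem contDiff_spatialPart {n : WithTop ℕ∞} : ContDiff ℝ n (spatialPart F) :=
  @ContinuousLinearMap.contDiff ℝ ((ℝ × F) →L[ℝ] (ℝ × F) →L[ℝ] ℝ) (F →L[ℝ] F →L[ℝ] ℝ) _ _ _ _ _ n
    (spatialPart F)

variable (G : ℝ × F → (ℝ × F) →L[ℝ] (ℝ × F) →L[ℝ] ℝ)

/-- The **induced metric of the slice** `{0} × F`: `h_y(v, w) = G_{(0,y)}(ṽ, w̃)`.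
[cite: Wald1984, (10.2.9)] -/
def sliceMetric (y : F) : F →L[ℝ] F →L[ℝ] ℝ :=
  spatialPart F (G (svec y))

/-- The **second fundamental form of the slice** in Gaussian form: `K_y(v, w) = ½ ∂_t G_{(0,y)}(ṽ, w̃)`
(`= G(∇_ṽ e₀, w̃)` when `G` is Gaussian along the slice, `sliceK_eq_apply_chrAt`).
[cite: Wald1984, (10.2.13)] -/
def sliceK (y : F) : F →L[ℝ] F →L[ℝ] ℝ :=
  (2⁻¹ : ℝ) • spatialPart F (fderiv ℝ G (svec y) tvec)

/-- **`G` is Gaussian to second order along the slice `{0} × B`**: at every point of the slice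
`G(e₀, e₀) = −1`, `G(e₀, ṽ) = 0` for all spatial `ṽ`, and `∂_t G(e₀, ·) = 0` (the `t`-lines are unit,
orthogonal to the slice and unaccelerated there). [cite: Wald1984, §3.3, (3.3.26)] -/
structure IsGaussianSlice (B : Set F) : Prop where
  g00 : ∀ y ∈ B, G (svec y) tvec tvec = -1
  g0x : ∀ y ∈ B, ∀ v : F, G (svec y) tvec (svec v) = 0
  dg0 : ∀ y ∈ B, ∀ w : ℝ × F, fderiv ℝ G (svec y) tvec tvec w = 0

variable {G} {T : Set (ℝ × F)} {B : Set F} {y : F}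

/-- Unfolding lemma for `sliceMetric`. [cite: Wald1984, (10.2.9)] -/
@[simp] theorem sliceMetric_apply (y : F) (v w : F) : sliceMetric G y v w = G (svec y) (svec v) (svec w) := rfl

/-- Unfolding lemma for `sliceK`. [cite: Wald1984, (10.2.13)] -/
@[simp] theorem sliceK_apply (y : F) (v w : F) :
    sliceK G y v w = 2⁻¹ * fderiv ℝ G (svec y) tvec (svec v) (svec w) := by
  simp [sliceK]

/-- The slice metric of a `C^n` field of forms is `C^n` along the slice. [folklore] -/
theorem contDiffOn_sliceMetric {n : WithTop ℕ∞} (hG : ContDiffOn ℝ n G T) (hBT : ∀ y ∈ B, svec y ∈ T) :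
    ContDiffOn ℝ n (sliceMetric G) B := by
  have h1 : ContDiffOn ℝ n (fun y' : F ↦ G (svec y')) B :=
    hG.comp (contDiff_prodMk_right (0 : ℝ)).contDiffOn fun y' hy' ↦ hBT y' hy'
  exact contDiff_spatialPart.comp_contDiffOn h1

/-- The slice metric of a metric is smooth at slice points. [folklore] -/
theorem contDiffAt_sliceMetric (hG : IsMetricOn G T) (hBT : ∀ y ∈ B, svec y ∈ T) (hy : y ∈ B) :
    ContDiffAt ℝ ∞ (sliceMetric G) y := by
  have h1 : ContDiffAt ℝ ∞ (fun y' : F ↦ G (svec y')) y :=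
    (hG.contDiffAt (hBT y hy)).comp y (contDiff_prodMk_right (0 : ℝ)).contDiffAt
  exact (contDiff_spatialPart (F := F)).contDiffAt.comp y h1

/-- The slice metric of a metric is differentiable at slice points. [folklore] -/
theorem differentiableAt_sliceMetric (hG : IsMetricOn G T) (hBT : ∀ y ∈ B, svec y ∈ T) (hy : y ∈ B) :
    DifferentiableAt ℝ (sliceMetric G) y :=
  (contDiffAt_sliceMetric hG hBT hy).differentiableAt (by simp)

/-! ### Zeroth and first order along the slice -/

section FirstOrder

variable (hG : IsMetricOn G T) (hS : IsGaussianSlice G B)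
include hG hS

/-- `G(ṽ, e₀) = 0` on the slice. [cite: Wald1984, §3.3] -/
theorem gx0 (hBT : ∀ y ∈ B, svec y ∈ T) (hy : y ∈ B) (v : F) : G (svec y) (svec v) tvec = 0 := by
  rw [hG.symm _ (hBT y hy), hS.g0x y hy v]

omit hG in
/-- **`G(e₀, w) = −w.1`** on the slice. [cite: Wald1984, §3.3] -/
theorem apply_tvec (hy : y ∈ B) (w : ℝ × F) : G (svec y) tvec w = -w.1 := by
  conv_lhs => rw [eq_smul_tvec_add_svec w]
  rw [map_add, map_smul, hS.g00 y hy, hS.g0x y hy]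
  simp

/-- **`G(ṽ, w) = h(v, w.2)`** on the slice. [cite: Wald1984, (10.2.9)] -/
theorem apply_svec (hBT : ∀ y ∈ B, svec y ∈ T) (hy : y ∈ B) (v : F) (w : ℝ × F) :
    G (svec y) (svec v) w = sliceMetric G y v w.2 := by
  conv_lhs => rw [eq_smul_tvec_add_svec w]
  rw [map_add, map_smul, gx0 hG hS hBT hy v, sliceMetric_apply]
  simp

/-- **`G(V, W) = −V.1 W.1 + h(V.2, W.2)`** on the slice: the metric is block diagonal.
[cite: Wald1984, §3.3] -/
theorem apply_eq (hBT : ∀ y ∈ B, svec y ∈ T) (hy : y ∈ B) (V W : ℝ × F) :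
    G (svec y) V W = -(V.1 * W.1) + sliceMetric G y V.2 W.2 := by
  conv_lhs => rw [eq_smul_tvec_add_svec V]
  rw [map_add, map_smul, _root_.add_apply, _root_.smul_apply, apply_tvec hS hy,
    apply_svec hG hS hBT hy]
  simp [smul_eq_mul]

/-- `∂_t G(w, e₀) = 0` on the slice (the Gaussian condition, symmetrised). [cite: Wald1984, §3.3] -/
theorem dg0' (hBT : ∀ y ∈ B, svec y ∈ T) (hy : y ∈ B) (w : ℝ × F) : fderiv ℝ G (svec y) tvec w tvec = 0 := by
  rw [hG.fderiv_symm (hBT y hy), hS.dg0 y hy w]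

omit hS in
/-- Chain rule for the metric read along the slice: `∂_v (G(0,·)(Y,Z))(y) = DG_{(0,y)}(ṽ)(Y,Z)`.
[folklore] -/
theorem fderiv_slice_apply₂ (hBT : ∀ y ∈ B, svec y ∈ T) (hy : y ∈ B) (Y Z : ℝ × F) (v : F) :
    fderiv ℝ (fun y' : F ↦ G (svec y') Y Z) y v = fderiv ℝ G (svec y) (svec v) Y Z := by
  have hx := hBT y hy
  have hd : DifferentiableAt ℝ (fun x ↦ G x Y Z) (svec y) :=
    differentiableAt_clm_apply_const (differentiableAt_clm_apply_const (hG.differentiableAt hx) Y) Z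
  rw [fderiv_comp_svec hd, hG.fderiv_apply₂ hx]

/-- **Spatial derivatives of `G(e₀, e₀)` vanish on the slice**: `DG(ṽ)(e₀, e₀) = 0`.
[cite: Wald1984, §3.3] -/
theorem fderiv_svec_tvec_tvec (hB : IsOpen B) (hBT : ∀ y ∈ B, svec y ∈ T) (hy : y ∈ B) (v : F) :
    fderiv ℝ G (svec y) (svec v) tvec tvec = 0 := by
  rw [← fderiv_slice_apply₂ hG hBT hy,
    fderiv_eq_zero_of_eqOn_const hB (c := (-1 : ℝ)) (fun y' hy' ↦ hS.g00 y' hy') hy]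
  rfl

/-- **Spatial derivatives of `G(e₀, ũ)` vanish on the slice**: `DG(ṽ)(e₀, ũ) = 0`.
[cite: Wald1984, §3.3] -/
theorem fderiv_svec_tvec_svec (hB : IsOpen B) (hBT : ∀ y ∈ B, svec y ∈ T) (hy : y ∈ B) (v u : F) :
    fderiv ℝ G (svec y) (svec v) tvec (svec u) = 0 := by
  rw [← fderiv_slice_apply₂ hG hBT hy,
    fderiv_eq_zero_of_eqOn_const hB (c := (0 : ℝ)) (fun y' hy' ↦ hS.g0x y' hy' u) hy]
  rfl

/-- `DG(ṽ)(ũ, e₀) = 0` on the slice. [cite: Wald1984, §3.3] -/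
theorem fderiv_svec_svec_tvec (hB : IsOpen B) (hBT : ∀ y ∈ B, svec y ∈ T) (hy : y ∈ B) (v u : F) :
    fderiv ℝ G (svec y) (svec v) (svec u) tvec = 0 := by
  rw [hG.fderiv_symm (hBT y hy), fderiv_svec_tvec_svec hG hS hB hBT hy]

/-- `DG(ṽ)(e₀, W) = 0` on the slice, for every `W`. [cite: Wald1984, §3.3] -/
theorem fderiv_svec_tvec (hB : IsOpen B) (hBT : ∀ y ∈ B, svec y ∈ T) (hy : y ∈ B) (v : F) (W : ℝ × F) :
    fderiv ℝ G (svec y) (svec v) tvec W = 0 := by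
  conv_lhs => rw [eq_smul_tvec_add_svec W]
  rw [map_add, map_smul, fderiv_svec_tvec_tvec hG hS hB hBT hy, fderiv_svec_tvec_svec hG hS hB hBT hy]
  simp

omit hS in
/-- `∂_ṽ G(ũ, w̃) = ∂_v h(u, w)`: spatial derivatives of spatial components are those of `h`.
[cite: Wald1984, (10.2.9)] -/
theorem fderiv_svec_svec_svec (hBT : ∀ y ∈ B, svec y ∈ T) (hy : y ∈ B) (v u w : F) :
    fderiv ℝ G (svec y) (svec v) (svec u) (svec w) = fderiv ℝ (sliceMetric G) y v u w := by
  rw [← fderiv_slice_apply₂ hG hBT hy]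
  have hd : DifferentiableAt ℝ (sliceMetric G) y := differentiableAt_sliceMetric hG hBT hy
  have h2 : fderiv ℝ (sliceMetric G) y v u w = fderiv ℝ (fun y' ↦ sliceMetric G y' u w) y v := by
    rw [fderiv_clm_apply_const (differentiableAt_clm_apply_const hd u) w v,
      fderiv_clm_apply_const hd u v]
  rw [h2]
  rfl

end FirstOrder

/-! ### The slice metric is a metric; the adapted basis and the inverse metric -/

section Metric

/-- **Nondegeneracy**: `G_x(u, ·) = 0` forces `u = 0` at the points of `T`. [folklore] -/
theorem eq_zero_of_forall_apply (hG : IsMetricOn G T) {x : ℝ × F} (hx : x ∈ T) {u : ℝ × F}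
    (h : ∀ w, G x u w = 0) : u = 0 := by
  obtain ⟨e, he⟩ := hG.isInvertible x hx
  have h1 : (e : (ℝ × F) →L[ℝ] ((ℝ × F) →L[ℝ] ℝ)) u = 0 := by
    rw [he]; exact ContinuousLinearMap.ext fun w ↦ h w
  have h2 : e u = 0 := by simpa using h1
  exact e.map_eq_zero_iff.1 h2

/-- Two vectors with the same pairings `G_x(u, ·) = G_x(v, ·)` are equal. [folklore] -/
theorem ext_of_forall_apply (hG : IsMetricOn G T) {x : ℝ × F} (hx : x ∈ T) {u v : ℝ × F}
    (h : ∀ w, G x u w = G x v w) : u = v := by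
  have h0 : u - v = 0 := eq_zero_of_forall_apply hG hx fun w ↦ by
    rw [map_sub, _root_.sub_apply, h w, sub_self]
  exact sub_eq_zero.1 h0

variable [FiniteDimensional ℝ F]

/-- **The induced metric of a Gaussian slice is a (nondegenerate, smooth, symmetric) metric** on
`B` (the block `h` of the block-diagonal `G|_Σ` is nondegenerate; O'Neill 1983, Ch. 3, Lemma 3.4 ff.).
[cite: Wald1984, (10.2.9)] -/
theorem isMetricOn_sliceMetric (hG : IsMetricOn G T) (hS : IsGaussianSlice G B) (hB : IsOpen B)
    (hBT : ∀ y ∈ B, svec y ∈ T) : IsMetricOn (sliceMetric G) B where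
  isOpen := hB
  contDiffOn := contDiffOn_sliceMetric hG.contDiffOn hBT
  symm y hy v w := by
    rw [sliceMetric_apply, sliceMetric_apply, hG.symm _ (hBT y hy)]
  isInvertible y hy := isInvertible_of_nondegenerate fun v hv ↦ by
    have h0 : svec v = (0 : ℝ × F) := eq_zero_of_forall_apply hG (hBT y hy) fun w ↦ by
      rw [apply_svec hG hS hBT hy, hv]
    simpa using congrArg Prod.snd h0

/-- **Index raising on the slice**: `♯_G α = −α(e₀) e₀ + (♯_h (α|_F))~` at slice points.
[cite: Wald1984, §3.3] -/
theorem sharpAt_eq (hG : IsMetricOn G T) (hS : IsGaussianSlice G B) (hB : IsOpen B)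
    (hBT : ∀ y ∈ B, svec y ∈ T) (hy : y ∈ B) (α : (ℝ × F) →L[ℝ] ℝ) :
    sharpAt G (svec y) α =
      (-α tvec) • (tvec : ℝ × F) + svec (sharpAt (sliceMetric G) y (α.comp (inr ℝ ℝ F))) := by
  have hh := isMetricOn_sliceMetric hG hS hB hBT
  refine sharpAt_eq_of_forall (hG.isInvertible _ (hBT y hy)) fun w ↦ ?_
  rw [map_add, map_smul, _root_.add_apply, _root_.smul_apply, apply_tvec hS hy,
    apply_svec hG hS hBT hy, apply_sharpAt_apply (hh.isInvertible y hy)]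
  conv_rhs => rw [eq_smul_tvec_add_svec w, map_add, map_smul]
  simp only [ContinuousLinearMap.comp_apply, inr_apply, smul_eq_mul]
  ring

variable {ι : Type*} [Fintype ι] (b₀ : Basis ι ℝ F)

/-- **The adapted basis** `(e₀, b̃₁, …, b̃ₙ)` of `ℝ × F` built from a basis `b` of `F`, indexed by
`Option ι` (`none ↦ e₀`, `some i ↦ b̃ᵢ`). [folklore] -/
def sliceBasis : Basis (Option ι) ℝ (ℝ × F) :=
  ((Basis.singleton Unit ℝ).prod b₀).reindex
    ((Equiv.sumComm Unit ι).trans (Equiv.optionEquivSumPUnit ι).symm)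

omit [FiniteDimensional ℝ F] [Fintype ι] in
/-- `e₀` is the `none`-th adapted basis vector. [folklore] -/
@[simp] theorem sliceBasis_none : sliceBasis b₀ none = tvec := by
  rw [sliceBasis, Basis.reindex_apply]
  simp [Basis.prod_apply, tvec]

omit [FiniteDimensional ℝ F] [Fintype ι] in
/-- `b̃ᵢ` is the `some i`-th adapted basis vector. [folklore] -/
@[simp] theorem sliceBasis_some (i : ι) : sliceBasis b₀ (some i) = svec (b₀ i) := by
  rw [sliceBasis, Basis.reindex_apply]
  simp [Basis.prod_apply, svec]

omit [FiniteDimensional ℝ F] [Fintype ι] in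
/-- The `none`-th adapted coordinate is the time component. [folklore] -/
@[simp] theorem sliceBasis_coord_none (w : ℝ × F) : (sliceBasis b₀).coord none w = w.1 := by
  rw [Basis.coord_apply, sliceBasis, Basis.repr_reindex_apply]
  simp [Basis.prod_repr_inl]

omit [FiniteDimensional ℝ F] [Fintype ι] in
/-- The `some i`-th adapted coordinate is the `i`-th coordinate of the spatial component.
[folklore] -/
@[simp] theorem sliceBasis_coord_some (i : ι) (w : ℝ × F) :
    (sliceBasis b₀).coord (some i) w = b₀.coord i w.2 := by
  rw [Basis.coord_apply, Basis.coord_apply, sliceBasis, Basis.repr_reindex_apply]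
  simp [Basis.prod_repr_inr]

end Metric

section Ginv

variable [FiniteDimensional ℝ F] {ι : Type*} [Fintype ι] (b₀ : Basis ι ℝ F)
  (hG : IsMetricOn G T) (hS : IsGaussianSlice G B)
include hG hS

omit [Fintype ι] in
/-- `♯ e⁰ = −e₀` on the slice (`e⁰` the time coordinate functional). [cite: Wald1984, §3.3] -/
theorem sharpAt_coordCLM_none (hBT : ∀ y ∈ B, svec y ∈ T) (hy : y ∈ B) :
    sharpAt G (svec y) (coordCLM (sliceBasis b₀) none) = -tvec := by
  refine sharpAt_eq_of_forall (hG.isInvertible _ (hBT y hy)) fun w ↦ ?_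
  rw [map_neg, _root_.neg_apply, apply_tvec hS hy, coordCLM_apply, sliceBasis_coord_none, neg_neg]

omit [Fintype ι] in
/-- `♯ bⁱ = (♯_h bⁱ)~` on the slice (spatial coordinate functionals are raised with `h`).
[cite: Wald1984, §3.3] -/
theorem sharpAt_coordCLM_some (hB : IsOpen B) (hBT : ∀ y ∈ B, svec y ∈ T) (hy : y ∈ B) (j : ι) :
    sharpAt G (svec y) (coordCLM (sliceBasis b₀) (some j)) =
      svec (sharpAt (sliceMetric G) y (coordCLM b₀ j)) := by
  have hh := isMetricOn_sliceMetric hG hS hB hBT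
  refine sharpAt_eq_of_forall (hG.isInvertible _ (hBT y hy)) fun w ↦ ?_
  rw [apply_svec hG hS hBT hy, apply_sharpAt_apply (hh.isInvertible y hy), coordCLM_apply,
    coordCLM_apply, sliceBasis_coord_some]

omit [Fintype ι] in
/-- **`g⁰⁰ = −1`** on the slice. [cite: Wald1984, §3.3] -/
theorem ginv_none_none (hBT : ∀ y ∈ B, svec y ∈ T) (hy : y ∈ B) :
    ginv G (sliceBasis b₀) (svec y) none none = -1 := by
  rw [ginv, sharpAt_coordCLM_none b₀ hG hS hBT hy, map_neg, sliceBasis_coord_none]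

omit [Fintype ι] in
/-- **`gⁱ⁰ = 0`** on the slice. [cite: Wald1984, §3.3] -/
theorem ginv_some_none (hBT : ∀ y ∈ B, svec y ∈ T) (hy : y ∈ B) (i : ι) :
    ginv G (sliceBasis b₀) (svec y) (some i) none = 0 := by
  rw [ginv, sharpAt_coordCLM_none b₀ hG hS hBT hy, map_neg, sliceBasis_coord_some]
  simp

omit [Fintype ι] in
/-- **`g⁰ʲ = 0`** on the slice. [cite: Wald1984, §3.3] -/
theorem ginv_none_some (hB : IsOpen B) (hBT : ∀ y ∈ B, svec y ∈ T) (hy : y ∈ B) (j : ι) :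
    ginv G (sliceBasis b₀) (svec y) none (some j) = 0 := by
  rw [ginv, sharpAt_coordCLM_some b₀ hG hS hB hBT hy, sliceBasis_coord_none]

omit [Fintype ι] in
/-- **`gⁱʲ = hⁱʲ`** on the slice. [cite: Wald1984, §3.3] -/
theorem ginv_some_some (hB : IsOpen B) (hBT : ∀ y ∈ B, svec y ∈ T) (hy : y ∈ B) (i j : ι) :
    ginv G (sliceBasis b₀) (svec y) (some i) (some j) = ginv (sliceMetric G) b₀ y i j := by
  rw [ginv, ginv, sharpAt_coordCLM_some b₀ hG hS hB hBT hy, sliceBasis_coord_some]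

/-- **Contraction with the inverse metric on the slice**:
`Σ_{ab} g^{ab} M_{ab} = −M₀₀ + Σ_{ij} h^{ij} M_{ij}`. [cite: Wald1984, §3.3] -/
theorem sum_ginv_mul (hB : IsOpen B) (hBT : ∀ y ∈ B, svec y ∈ T) (hy : y ∈ B)
    (M : Option ι → Option ι → ℝ) :
    ∑ a, ∑ c, ginv G (sliceBasis b₀) (svec y) a c * M a c =
      -M none none + ∑ i, ∑ j, ginv (sliceMetric G) b₀ y i j * M (some i) (some j) := by
  rw [Fintype.sum_option]
  simp only [Fintype.sum_option, ginv_none_none b₀ hG hS hBT hy, ginv_none_some b₀ hG hS hB hBT hy,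
    ginv_some_none b₀ hG hS hBT hy, ginv_some_some b₀ hG hS hB hBT hy]
  simp

end Ginv

/-! ### The Christoffel symbols along the slice -/

section ChristoffelSlice

variable [FiniteDimensional ℝ F] (hG : IsMetricOn G T) (hS : IsGaussianSlice G B)
include hG hS

omit [FiniteDimensional ℝ F] in
/-- **`Γ(e₀, e₀) = 0` on the slice** (the `t`-lines are geodesic to first order at `Σ`:
`Γ^a_{00} = 0`). [cite: Wald1984, §3.3] -/
theorem chrAt_tvec_tvec (hB : IsOpen B) (hBT : ∀ y ∈ B, svec y ∈ T) (hy : y ∈ B) :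
    chrAt G (svec y) tvec tvec = 0 := by
  have hx := hBT y hy
  refine eq_zero_of_forall_apply hG hx fun w ↦ ?_
  rw [apply_chrAt (hG.isInvertible _ hx), koszulCLM_apply, hS.dg0 y hy, dg0' hG hS hBT hy]
  conv_lhs => rw [eq_smul_tvec_add_svec w, map_add, map_smul]
  rw [_root_.add_apply, _root_.smul_apply, _root_.add_apply, _root_.smul_apply, hS.dg0 y hy,
    fderiv_svec_tvec_tvec hG hS hB hBT hy]
  simp

/-- **`Γ(e₀, ṽ) = (♯_h K(v, ·))~` on the slice** (`Γ^j_{0i} = K_i{}^j`, `Γ^0_{0i} = 0`).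
[cite: Wald1984, §10.2] -/
theorem chrAt_tvec_svec (hB : IsOpen B) (hBT : ∀ y ∈ B, svec y ∈ T) (hy : y ∈ B) (v : F) :
    chrAt G (svec y) tvec (svec v) = svec (sharpAt (sliceMetric G) y (sliceK G y v)) := by
  have hx := hBT y hy
  have hh := isMetricOn_sliceMetric hG hS hB hBT
  refine ext_of_forall_apply hG hx fun w ↦ ?_
  rw [apply_chrAt (hG.isInvertible _ hx), koszulCLM_apply, apply_svec hG hS hBT hy,
    apply_sharpAt_apply (hh.isInvertible y hy), sliceK_apply]
  conv_lhs => rw [eq_smul_tvec_add_svec w]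
  simp only [map_add, map_smul, _root_.add_apply, _root_.smul_apply, smul_eq_mul]
  rw [hG.fderiv_symm hx tvec (svec v) tvec, hS.dg0 y hy, fderiv_svec_tvec_tvec hG hS hB hBT hy,
    fderiv_svec_svec_tvec hG hS hB hBT hy, fderiv_svec_tvec_svec hG hS hB hBT hy]
  ring

/-- `Γ(ṽ, e₀) = (♯_h K(v, ·))~` on the slice. [cite: Wald1984, §10.2] -/
theorem chrAt_svec_tvec (hB : IsOpen B) (hBT : ∀ y ∈ B, svec y ∈ T) (hy : y ∈ B) (v : F) :
    chrAt G (svec y) (svec v) tvec = svec (sharpAt (sliceMetric G) y (sliceK G y v)) := by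
  rw [hG.chrAt_comm (hBT y hy), chrAt_tvec_svec hG hS hB hBT hy]

/-- **`Γ(ṽ, w̃) = K(v, w) e₀ + (Γ_h(v, w))~` on the slice** (`Γ^0_{ij} = K_{ij}`,
`Γ^k_{ij} = Γ^k_{ij}[h]`). [cite: Wald1984, §10.2] -/
theorem chrAt_svec_svec (hB : IsOpen B) (hBT : ∀ y ∈ B, svec y ∈ T) (hy : y ∈ B) (v w : F) :
    chrAt G (svec y) (svec v) (svec w) =
      sliceK G y v w • (tvec : ℝ × F) + svec (chrAt (sliceMetric G) y v w) := by
  have hx := hBT y hy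
  have hh := isMetricOn_sliceMetric hG hS hB hBT
  refine ext_of_forall_apply hG hx fun z ↦ ?_
  rw [map_add, map_smul, _root_.add_apply, _root_.smul_apply, apply_tvec hS hy,
    apply_svec hG hS hBT hy, apply_chrAt (hh.isInvertible y hy), koszulCLM_apply,
    apply_chrAt (hG.isInvertible _ hx), koszulCLM_apply, sliceK_apply]
  conv_lhs => rw [eq_smul_tvec_add_svec z]
  simp only [map_add, map_smul, _root_.add_apply, _root_.smul_apply, smul_eq_mul]
  simp only [fderiv_svec_svec_tvec hG hS hB hBT hy, fderiv_svec_tvec_svec hG hS hB hBT hy,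
    fderiv_svec_svec_svec hG hBT hy]
  ring

end ChristoffelSlice

/-! ### Second order along the slice -/

section SecondOrder

variable (hG : IsMetricOn G T) (hS : IsGaussianSlice G B)
include hG hS

omit hS in
/-- `K` is symmetric: `K(v, w) = K(w, v)`. [cite: Wald1984, (10.2.13)] -/
theorem sliceK_comm (hBT : ∀ y ∈ B, svec y ∈ T) (hy : y ∈ B) (v w : F) :
    sliceK G y v w = sliceK G y w v := by
  rw [sliceK_apply, sliceK_apply, hG.fderiv_symm (hBT y hy)]

omit hS in
/-- `K` is smooth along the slice. [folklore] -/
theorem contDiffAt_sliceK (hBT : ∀ y ∈ B, svec y ∈ T) (hy : y ∈ B) :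
    ContDiffAt ℝ ∞ (sliceK G) y := by
  have h1 : ContDiffAt ℝ ∞ (fun y' : F ↦ fderiv ℝ G (svec y')) y :=
    (hG.contDiffAt_fderiv (hBT y hy)).comp y (contDiff_prodMk_right (0 : ℝ)).contDiffAt
  have h2 : ContDiffAt ℝ ∞ (fun y' : F ↦ fderiv ℝ G (svec y') tvec) y := h1.clm_apply contDiffAt_const
  have h3 := ((contDiff_spatialPart (F := F)).contDiffAt.comp y h2).const_smul (2⁻¹ : ℝ)
  exact h3

omit hS in
/-- `K` is differentiable along the slice. [folklore] -/
theorem differentiableAt_sliceK (hBT : ∀ y ∈ B, svec y ∈ T) (hy : y ∈ B) :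
    DifferentiableAt ℝ (sliceK G) y :=
  (contDiffAt_sliceK hG hBT hy).differentiableAt (by simp)

omit hS in
/-- `K` is smooth on the slice. [folklore] -/
theorem contDiffOn_sliceK (hBT : ∀ y ∈ B, svec y ∈ T) : ContDiffOn ℝ ∞ (sliceK G) B :=
  fun _ hy ↦ (contDiffAt_sliceK hG hBT hy).contDiffWithinAt

omit hS in
/-- Chain rule for `DG` read along the slice:
`∂_u (DG_{(0,·)}(v)(Y)(Z))(y) = D²G_{(0,y)}(ũ)(v)(Y)(Z)`. [folklore] -/
theorem fderiv_slice_fderiv_apply₃ (hBT : ∀ y ∈ B, svec y ∈ T) (hy : y ∈ B) (v Y Z : ℝ × F) (u : F) :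
    fderiv ℝ (fun y' : F ↦ fderiv ℝ G (svec y') v Y Z) y u =
      fderiv ℝ (fderiv ℝ G) (svec y) (svec u) v Y Z := by
  have hx := hBT y hy
  have hd : DifferentiableAt ℝ (fun x ↦ fderiv ℝ G x v Y Z) (svec y) :=
    differentiableAt_clm_apply_const (differentiableAt_clm_apply_const
      (differentiableAt_clm_apply_const (hG.differentiableAt_fderiv hx) v) Y) Z
  rw [fderiv_comp_svec hd, hG.fderiv_fderiv_apply₃ hx]

/-- **`D²G(ṽ)(e₀)(e₀, W) = 0` on the slice**: the Gaussian condition `∂_t G(e₀, ·) = 0` holds all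
along `Σ`, so its tangential derivatives vanish. [cite: Wald1984, §3.3] -/
theorem fderiv₂_svec_tvec_tvec (hB : IsOpen B) (hBT : ∀ y ∈ B, svec y ∈ T) (hy : y ∈ B) (v : F)
    (W : ℝ × F) : fderiv ℝ (fderiv ℝ G) (svec y) (svec v) tvec tvec W = 0 := by
  rw [← fderiv_slice_fderiv_apply₃ hG hBT hy,
    fderiv_eq_zero_of_eqOn_const hB (c := (0 : ℝ)) (fun y' hy' ↦ hS.dg0 y' hy' W) hy]
  rfl

/-- `D²G(e₀)(ṽ)(e₀, W) = 0` on the slice. [cite: Wald1984, §3.3] -/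
theorem fderiv₂_tvec_svec_tvec (hB : IsOpen B) (hBT : ∀ y ∈ B, svec y ∈ T) (hy : y ∈ B) (v : F)
    (W : ℝ × F) : fderiv ℝ (fderiv ℝ G) (svec y) tvec (svec v) tvec W = 0 := by
  rw [hG.fderiv_fderiv_comm (hBT y hy), fderiv₂_svec_tvec_tvec hG hS hB hBT hy]

/-- `D²G(e₀)(ṽ)(W, e₀) = 0` on the slice. [cite: Wald1984, §3.3] -/
theorem fderiv₂_tvec_svec_apply_tvec (hB : IsOpen B) (hBT : ∀ y ∈ B, svec y ∈ T) (hy : y ∈ B)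
    (v : F) (W : ℝ × F) : fderiv ℝ (fderiv ℝ G) (svec y) tvec (svec v) W tvec = 0 := by
  rw [hG.fderiv_fderiv_symm (hBT y hy), fderiv₂_tvec_svec_tvec hG hS hB hBT hy]

/-- `D²G(ṽ)(e₀)(W, e₀) = 0` on the slice. [cite: Wald1984, §3.3] -/
theorem fderiv₂_svec_tvec_apply_tvec (hB : IsOpen B) (hBT : ∀ y ∈ B, svec y ∈ T) (hy : y ∈ B)
    (v : F) (W : ℝ × F) : fderiv ℝ (fderiv ℝ G) (svec y) (svec v) tvec W tvec = 0 := by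
  rw [hG.fderiv_fderiv_symm (hBT y hy), fderiv₂_svec_tvec_tvec hG hS hB hBT hy]

/-- **`D²G(ṽ)(ũ)(e₀, e₀) = 0` on the slice**: `G(e₀, e₀) = −1` all along `Σ`, twice
differentiated tangentially. [cite: Wald1984, §3.3] -/
theorem fderiv₂_svec_svec_tvec_tvec (hB : IsOpen B) (hBT : ∀ y ∈ B, svec y ∈ T) (hy : y ∈ B)
    (v u : F) : fderiv ℝ (fderiv ℝ G) (svec y) (svec v) (svec u) tvec tvec = 0 := by
  rw [← fderiv_slice_fderiv_apply₃ hG hBT hy,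
    fderiv_eq_zero_of_eqOn_const hB (c := (0 : ℝ))
      (fun y' hy' ↦ fderiv_svec_tvec_tvec hG hS hB hBT hy' u) hy]
  rfl

omit hS in
/-- **`D²G(ṽ)(e₀)(ũ, w̃) = 2 ∂_v K(u, w)` on the slice**: the tangential derivative of
`∂_t G(ũ, w̃) = 2K(u, w)`. [cite: Wald1984, (10.2.13)] -/
theorem fderiv₂_svec_tvec_svec_svec (hBT : ∀ y ∈ B, svec y ∈ T) (hy : y ∈ B) (v u w : F) :
    fderiv ℝ (fderiv ℝ G) (svec y) (svec v) tvec (svec u) (svec w) =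
      2 * fderiv ℝ (sliceK G) y v u w := by
  rw [← fderiv_slice_fderiv_apply₃ hG hBT hy]
  have h1 : (fun y' : F ↦ fderiv ℝ G (svec y') tvec (svec u) (svec w)) =
      fun y' ↦ 2 * sliceK G y' u w := by
    funext y'; rw [sliceK_apply]; ring
  have hd := differentiableAt_sliceK hG hBT hy
  have hd1 : DifferentiableAt ℝ (fun y' ↦ sliceK G y' u) y := differentiableAt_clm_apply_const hd u
  have hd2 : DifferentiableAt ℝ (fun y' ↦ sliceK G y' u w) y := differentiableAt_clm_apply_const hd1 w
  rw [h1, fderiv_const_mul hd2, _root_.smul_apply, smul_eq_mul, fderiv_clm_apply_const hd1 w v,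
    fderiv_clm_apply_const hd u v]

/-- **`∂_t G(V, W) = 2 K(V_F, W_F)` on the slice**: the time derivative of the metric has no `e₀`
components there. [cite: Wald1984, (10.2.13)] -/
theorem fderiv_tvec_apply (hBT : ∀ y ∈ B, svec y ∈ T) (hy : y ∈ B) (V W : ℝ × F) :
    fderiv ℝ G (svec y) tvec V W = 2 * sliceK G y V.2 W.2 := by
  conv_lhs => rw [eq_smul_tvec_add_svec V, eq_smul_tvec_add_svec W]
  simp only [map_add, map_smul, _root_.add_apply, _root_.smul_apply, smul_eq_mul, hS.dg0 y hy,
    dg0' hG hS hBT hy, sliceK_apply]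
  ring

/-- **`∂_t K(ṽ, w̃, e₀) = −∂_t∂_t G(ṽ, w̃)` on the slice** (`K` the Koszul form).
[cite: Wald1984, §10.2] -/
theorem fderiv_tvec_koszulCLM_svec_svec_tvec (hB : IsOpen B) (hBT : ∀ y ∈ B, svec y ∈ T)
    (hy : y ∈ B) (v w : F) :
    fderiv ℝ (fun x ↦ koszulCLM G x (svec v) (svec w) tvec) (svec y) tvec =
      -fderiv ℝ (fderiv ℝ G) (svec y) tvec tvec (svec v) (svec w) := by
  rw [hG.fderiv_koszulCLM_apply₃ (hBT y hy), fderiv₂_tvec_svec_apply_tvec hG hS hB hBT hy,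
    fderiv₂_tvec_svec_tvec hG hS hB hBT hy]
  ring

omit hS in
/-- **`∂_t K(ṽ, w̃, z̃) = 2 (∂_v K(w,z) + ∂_w K(z,v) − ∂_z K(v,w))` on the slice**.
[cite: Wald1984, §10.2] -/
theorem fderiv_tvec_koszulCLM_svec_svec_svec (hBT : ∀ y ∈ B, svec y ∈ T) (hy : y ∈ B)
    (v w z : F) :
    fderiv ℝ (fun x ↦ koszulCLM G x (svec v) (svec w) (svec z)) (svec y) tvec =
      2 * (fderiv ℝ (sliceK G) y v w z + fderiv ℝ (sliceK G) y w z v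
        - fderiv ℝ (sliceK G) y z v w) := by
  have hx := hBT y hy
  rw [hG.fderiv_koszulCLM_apply₃ hx, hG.fderiv_fderiv_comm hx tvec (svec v),
    hG.fderiv_fderiv_comm hx tvec (svec w), hG.fderiv_fderiv_comm hx tvec (svec z),
    fderiv₂_svec_tvec_svec_svec hG hBT hy, fderiv₂_svec_tvec_svec_svec hG hBT hy,
    fderiv₂_svec_tvec_svec_svec hG hBT hy]
  ring

end SecondOrder

/-! ### Curvature: the Gauss equation and the Ricci tensor on the slice -/

section CurvatureSlice

variable [FiniteDimensional ℝ F] [CompleteSpace F] (hG : IsMetricOn G T) (hS : IsGaussianSlice G B)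
include hG hS

omit [FiniteDimensional ℝ F] [CompleteSpace F] hS in
/-- The Koszul form on spatial vectors is that of `h`: `K_G(ũ, ṽ, w̃) = K_h(u, v, w)` on the slice.
[cite: ONeill1983, Ch. 3, Prop. 3.13] -/
theorem koszulCLM_svec (hBT : ∀ y ∈ B, svec y ∈ T) (hy : y ∈ B) (u v w : F) :
    koszulCLM G (svec y) (svec u) (svec v) (svec w) = koszulCLM (sliceMetric G) y u v w := by
  rw [koszulCLM_apply, koszulCLM_apply, fderiv_svec_svec_svec hG hBT hy,
    fderiv_svec_svec_svec hG hBT hy, fderiv_svec_svec_svec hG hBT hy]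

omit [FiniteDimensional ℝ F] [CompleteSpace F] hS in
/-- Tangential derivatives of the spatial Koszul form are those of `K_h`. [folklore] -/
theorem fderiv_koszulCLM_svec (hB : IsOpen B) (hBT : ∀ y ∈ B, svec y ∈ T) (hy : y ∈ B)
    (u v w z : F) :
    fderiv ℝ (fun x ↦ koszulCLM G x (svec u) (svec v) (svec w)) (svec y) (svec z) =
      fderiv ℝ (fun y' ↦ koszulCLM (sliceMetric G) y' u v w) y z := by
  have hx := hBT y hy
  rw [← fderiv_comp_svec (hG.differentiableAt_koszulCLM_apply₃ hx _ _ _)]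
  have heq : (fun y' : F ↦ koszulCLM G (svec y') (svec u) (svec v) (svec w)) =ᶠ[𝓝 y]
      fun y' ↦ koszulCLM (sliceMetric G) y' u v w :=
    Filter.eventually_of_mem (hB.mem_nhds hy) fun y' hy' ↦ koszulCLM_svec hG hBT hy' u v w
  rw [heq.fderiv_eq]

/-- **The Gauss equation** on the slice (O'Neill 1983, Ch. 4, Thm. 4.5 with a timelike unit normal,
`ε = −1`, second fundamental form `K(v,w) e₀`):
`G(R(ũ, ṽ)w̃, z̃) = h(R_h(u, v)w, z) + K(v, w)K(u, z) − K(u, w)K(v, z)`.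
[cite: ONeill1983, Ch. 4, Thm. 4.5] -/
theorem apply_riemAt_svec (hB : IsOpen B) (hBT : ∀ y ∈ B, svec y ∈ T) (hy : y ∈ B) (u v w z : F) :
    G (svec y) (riemAt G (svec y) (svec u) (svec v) (svec w)) (svec z) =
      sliceMetric G y (riemAt (sliceMetric G) y u v w) z
        + sliceK G y v w * sliceK G y u z - sliceK G y u w * sliceK G y v z := by
  have hx := hBT y hy
  have hh := isMetricOn_sliceMetric hG hS hB hBT
  rw [hG.apply_riemAt hx, hh.apply_riemAt hy, fderiv_koszulCLM_svec hG hB hBT hy,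
    fderiv_koszulCLM_svec hG hB hBT hy, chrAt_svec_svec hG hS hB hBT hy, chrAt_svec_svec hG hS hB hBT hy,
    chrAt_svec_svec hG hS hB hBT hy, chrAt_svec_svec hG hS hB hBT hy, apply_eq hG hS hBT hy,
    apply_eq hG hS hBT hy]
  simp only [Prod.fst_add, Prod.snd_add, Prod.smul_fst, Prod.smul_snd, smul_eq_mul, mul_one,
    smul_zero, zero_add, add_zero, sliceMetric_apply]
  ring

/-- **The normal curvature component** on the slice:
`G(R(e₀, ṽ)w̃, e₀) = −½ ∂_t∂_t G(ṽ, w̃) + K(w, ♯_h K(v, ·))` (the `e₀ṽw̃e₀` Riemann component in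
Gaussian coordinates; Wald 1984, §10.2, the computation leading to (10.2.25)).
[cite: Wald1984, §10.2] -/
theorem apply_riemAt_tvec (hB : IsOpen B) (hBT : ∀ y ∈ B, svec y ∈ T) (hy : y ∈ B) (v w : F) :
    G (svec y) (riemAt G (svec y) tvec (svec v) (svec w)) tvec =
      -(2⁻¹ * fderiv ℝ (fderiv ℝ G) (svec y) tvec tvec (svec v) (svec w))
        + sliceK G y w (sharpAt (sliceMetric G) y (sliceK G y v)) := by
  have hx := hBT y hy
  have hh := isMetricOn_sliceMetric hG hS hB hBT
  rw [hG.apply_riemAt hx, hG.fderiv_koszulCLM_apply₃ hx, hG.fderiv_koszulCLM_apply₃ hx,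
    chrAt_tvec_tvec hG hS hB hBT hy, chrAt_tvec_svec hG hS hB hBT hy, chrAt_svec_tvec hG hS hB hBT hy,
    map_zero, apply_svec hG hS hBT hy, fderiv₂_tvec_svec_apply_tvec hG hS hB hBT hy,
    fderiv₂_tvec_svec_tvec hG hS hB hBT hy, fderiv₂_svec_tvec_apply_tvec hG hS hB hBT hy,
    fderiv₂_svec_svec_tvec_tvec hG hS hB hBT hy, fderiv₂_svec_tvec_tvec hG hS hB hBT hy,
    apply_sharpAt_apply (hh.isInvertible y hy)]
  simp only [sub_zero, add_zero, zero_sub]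
  ring

omit [FiniteDimensional ℝ F] in
/-- **`G(∂_t Γ(ṽ, w̃), e₀) = −½ ∂_t∂_t G(ṽ, w̃)` on the slice** (time derivative of the
Christoffel map, normal component). [cite: Wald1984, §10.2] -/
theorem apply_fderiv_chrAt_tvec_tvec (hB : IsOpen B) (hBT : ∀ y ∈ B, svec y ∈ T) (hy : y ∈ B)
    (v w : F) :
    G (svec y) (fderiv ℝ (chrAt G) (svec y) tvec (svec v) (svec w)) tvec =
      -(2⁻¹ * fderiv ℝ (fderiv ℝ G) (svec y) tvec tvec (svec v) (svec w)) := by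
  rw [hG.apply_fderiv_chrAt (hBT y hy), fderiv_tvec_koszulCLM_svec_svec_tvec hG hS hB hBT hy,
    fderiv_tvec_apply hG hS hBT hy, show (tvec : ℝ × F).2 = (0 : F) from rfl, map_zero]
  ring

/-- **`G(∂_t Γ(ṽ, w̃), z̃) = ∂_v K(w,z) + ∂_w K(z,v) − ∂_z K(v,w) − 2 K(Γ_h(v,w), z)` on the
slice** (time derivative of the Christoffel map, tangential components). [cite: Wald1984, §10.2] -/
theorem apply_fderiv_chrAt_tvec_svec (hB : IsOpen B) (hBT : ∀ y ∈ B, svec y ∈ T) (hy : y ∈ B)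
    (v w z : F) :
    G (svec y) (fderiv ℝ (chrAt G) (svec y) tvec (svec v) (svec w)) (svec z) =
      fderiv ℝ (sliceK G) y v w z + fderiv ℝ (sliceK G) y w z v - fderiv ℝ (sliceK G) y z v w
        - 2 * sliceK G y (chrAt (sliceMetric G) y v w) z := by
  rw [hG.apply_fderiv_chrAt (hBT y hy), fderiv_tvec_koszulCLM_svec_svec_svec hG hBT hy,
    fderiv_tvec_apply hG hS hBT hy, chrAt_svec_svec hG hS hB hBT hy]
  simp only [Prod.snd_add, Prod.smul_snd, smul_zero, zero_add]
  ring

omit [CompleteSpace F] hS in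
/-- `Σᵢⱼ hⁱʲ K(bᵢ, w) K(v, bⱼ) = K(w, ♯_h K(v,·))` (contraction through the inverse slice metric).
[cite: ONeill1983, Ch. 3, pp. 60–61] -/
theorem sum_ginv_sliceK_sliceK {ι : Type*} [Fintype ι] (b₀ : Basis ι ℝ F)
    (hBT : ∀ y ∈ B, svec y ∈ T) (hy : y ∈ B) (v w : F) :
    ∑ i, ∑ j, ginv (sliceMetric G) b₀ y i j * (sliceK G y (b₀ i) w * sliceK G y v (b₀ j)) =
      sliceK G y w (sharpAt (sliceMetric G) y (sliceK G y v)) := by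
  have h1 : ∀ i, ∑ j, ginv (sliceMetric G) b₀ y i j * (sliceK G y (b₀ i) w * sliceK G y v (b₀ j)) =
      sliceK G y (b₀ i) w * b₀.coord i (sharpAt (sliceMetric G) y (sliceK G y v)) := by
    intro i
    rw [coord_sharpAt_eq_sum b₀, Finset.mul_sum]
    refine Finset.sum_congr rfl fun j _ ↦ ?_
    ring
  rw [Finset.sum_congr rfl fun i _ ↦ h1 i]
  set t := sharpAt (sliceMetric G) y (sliceK G y v)
  conv_rhs => rw [sliceK_comm hG hBT hy, ← b₀.sum_repr t]
  rw [map_sum, FunLike.coe_sum, Finset.sum_apply]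
  refine Finset.sum_congr rfl fun i _ ↦ ?_
  rw [map_smul, _root_.smul_apply, smul_eq_mul, mul_comm, Basis.coord_apply]

/-- **The Ricci tensor on spatial vectors of a Gaussian slice**:
`Ric_G(ṽ, w̃) = ½ ∂_t∂_t G(ṽ, w̃) + Ric_h(v, w) + (tr_h K) K(v, w) − 2 K(w, ♯_h K(v, ·))`
(the `ij`-components of the Ricci tensor in Gaussian normal coordinates; setting it to zero is the
vacuum evolution equation `∂_t K_{ij} = −Ric_{ij}[h] − (tr K) K_{ij} + 2 K_{il}K^l{}_j` of
Wald 1984, (10.2.25)–(10.2.27), at a point where lapse `= 1`, shift `= 0` to second order).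
[cite: Wald1984, (10.2.25)–(10.2.27)] -/
theorem ricAt_svec_svec (hB : IsOpen B) (hBT : ∀ y ∈ B, svec y ∈ T) (hy : y ∈ B) (v w : F) :
    ricAt G (svec y) (svec v) (svec w) =
      2⁻¹ * fderiv ℝ (fderiv ℝ G) (svec y) tvec tvec (svec v) (svec w)
        + ricAt (sliceMetric G) y v w + mtrAt (sliceMetric G) y (sliceK G y) * sliceK G y v w
        - 2 * sliceK G y w (sharpAt (sliceMetric G) y (sliceK G y v)) := by
  have hx := hBT y hy
  have hh := isMetricOn_sliceMetric hG hS hB hBT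
  set b₀ := Module.finBasis ℝ F
  rw [ricAt_eq_sum_ginv (sliceBasis b₀) (hG.isInvertible _ hx), sum_ginv_mul b₀ hG hS hB hBT hy,
    ricAt_eq_sum_ginv b₀ (hh.isInvertible y hy), mtrAt_eq_sum b₀]
  simp only [sliceBasis_none, sliceBasis_some, apply_riemAt_tvec hG hS hB hBT hy,
    apply_riemAt_svec hG hS hB hBT hy]
  simp only [mul_add, mul_sub, Finset.sum_add_distrib, Finset.sum_sub_distrib]
  have e1 : ∑ i, ∑ j, ginv (sliceMetric G) b₀ y i j * (sliceK G y v w * sliceK G y (b₀ i) (b₀ j)) =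
      (∑ i, ∑ j, ginv (sliceMetric G) b₀ y i j * sliceK G y (b₀ i) (b₀ j)) * sliceK G y v w := by
    rw [Finset.sum_mul]
    refine Finset.sum_congr rfl fun i _ ↦ ?_
    rw [Finset.sum_mul]
    refine Finset.sum_congr rfl fun j _ ↦ ?_
    ring
  rw [e1, sum_ginv_sliceK_sliceK hG b₀ hBT hy]
  ring

end CurvatureSlice

end GaussSlice

end MetricCoord

end Literature.Geometry.Lorentzian

end
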